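import Literature.Analysis.Asymptotics.LaplaceMethodCompactGroupProduct
import HarnessLib

/-!
# Laplace ∕ Gibbs concentration on a compact group and on `G^B` from QUALITATIVE hypotheses:
# `C²` in exponential coordinates + positive second variation ALONG EVERY LINE

Topic `Literature/Analysis/Asymptotics`; sequel of `LaplaceMethodCompactGroup.lean` ∕ `LaplaceMethodCompactGroupProduct.lean`
(`tendsto_gibbs_expectation_haar`, `_pi`: constant-free concentration of `e^{−βf}dμ∕Z_β` at a unique minimiser that is
non-degenerate in exponential coordinates, stated with an explicit Peano expansion `f(g₀Θ(e v)) = f(g₀) + ½⟪Av,v⟫ + o(‖v‖²)`).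
Everything here is PROVED; no definitions, no named facts.

WHAT THIS FILE ADDS — the consumer-side reformulation of non-degeneracy.  Lattice computations (e.g. the twisted-slab
Hessian files of cell `ym-ir`, row 43: `iteratedDeriv_two_lineAction`, `ladder_hessian_gap`) deliver the second variation
of the action ALONG LINES `t ↦ U₀·exp(t a)`, not a symmetric operator `A`.  Here the operator is manufactured (Riesz
representative of the second Fréchet derivative, symmetric by Schwarz; Mathlib `second_derivative_symmetric_of_eventually_of_real`,
the tree's `isLittleO_taylor_two` ∕ `iteratedDeriv_two_along_line`), criticality comes for free from minimality
(`IsLocalMin.fderiv_eq_zero`), and the hypotheses become: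
`F := v ↦ f(g₀·Θ(e v))` is `C²` at `0` (`ContDiffAt ℝ 2 F 0`) and `d²/dt²|₀ F(t v) > 0` for every `v ≠ 0`.

* §1 (Euclidean) `hasFDerivAt_data_of_contDiffAt_two`, `peano_two_of_contDiffAt_of_isMinOn` — from `ContDiffAt ℝ 2 F x₀` and a
  minimum at `x₀`: a symmetric positive-definite `A` with `⟪Ay,y⟫ = d²/dt²|₀ F(x₀ + t y)` and the Peano expansion, as an
  existence statement ready for `tendsto_laplaceMethod(_chart)`;
* §2 ★★ `tendsto_gibbs_expectation_haar_of_contDiffAt` (one compact group faithfully represented) and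
  ★★ `tendsto_gibbs_expectation_haar_pi_of_contDiffAt` (`G^B`, componentwise chart), `…_pi_specialUnitaryGroup_of_contDiffAt`.

HONEST FRAMING: calculus glue; width 0 by itself toward any lattice statement uniform in the volume or in `β`; the
Yang–Mills mass gap (Clay) is NOT touched; `R4` closes only `BalabanLadder.UV`.

## References
* K. W. Breitung, *Asymptotic Approximations for Probability Integrals*, LNM 1592 (1994), Thm 41 p. 56 (hypotheses: `f`
  twice continuously differentiable, `H_f(x*)` definite), Lemma 7 p. 12 (second derivatives in rotated coordinates). [Breitung1994]
* S. Helgason, *Groups and Geometric Analysis*, AMS (2000), Ch. I §1 Thm 1.14 p. 96. [Helgason2000]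
* C.-R. Hwang, Ann. Probab. 8 (1980) 1177–1182. [Hwang1980]
-/

noncomputable section

open _root_.MeasureTheory _root_.Filter _root_.Set _root_.Module _root_.Topology
open scoped _root_.Real _root_.InnerProductSpace _root_.ENNReal _root_.NNReal
open Literature.MathematicalPhysics.QuantumFieldTheory.Balaban1983to89
open Literature.MathematicalPhysics.QuantumFieldTheory.Balaban1983to89.HaarExponentialChart
open Literature.MathematicalPhysics.QuantumFieldTheory.Balaban1983to89.LogChartProduct

namespace Literature.Analysis.Asymptotics

/-! ## §1 From `C²` and a minimum to the Peano expansion with a symmetric positive-definite operator -/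

section Euclidean

variable {V : Type*} [NormedAddCommGroup V] [InnerProductSpace ℝ V] [FiniteDimensional ℝ V]

omit [FiniteDimensional ℝ V] in
/-- `C²` at a point, unpacked into the `HasFDerivAt` data of `isLittleO_taylor_two` ∕ `iteratedDeriv_two_along_line`:
`F` is differentiable near `x₀` with derivative `fderiv F`, which is differentiable at `x₀`.
[cite: Breitung1994, Thm 41 p. 56 (hypothesis «twice continuously differentiable»)] -/
theorem hasFDerivAt_data_of_contDiffAt_two {F : V → ℝ} {x₀ : V} (hF : ContDiffAt ℝ 2 F x₀) :
    (∀ᶠ x in 𝓝 x₀, HasFDerivAt F (fderiv ℝ F x) x) ∧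
      HasFDerivAt (fderiv ℝ F) (fderiv ℝ (fderiv ℝ F) x₀) x₀ := by
  refine ⟨?_, ?_⟩
  · have h1 : ∀ᶠ x in 𝓝 x₀, ContDiffAt ℝ 2 F x := hF.eventually (by simp)
    exact h1.mono fun x hx => (hx.differentiableAt (by simp)).hasFDerivAt
  · have h2 : ContDiffAt ℝ 1 (fderiv ℝ F) x₀ := hF.fderiv_right (by norm_num)
    exact (h2.differentiableAt (by simp)).hasFDerivAt

/-- **Peano expansion at a minimum from `C²` + positive second variation along lines.**  If `F : V → ℝ` is `C²` at `x₀`,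
has a (local) minimum at `x₀`, and `d²/dt²|₀ F(x₀ + t y) > 0` for every `y ≠ 0`, then there is a symmetric operator
`A` on `V` with `⟪Ay, y⟫ = d²/dt²|₀ F(x₀ + t y) > 0` (`y ≠ 0`) and
`F(x) = F(x₀) + ½⟪A(x − x₀), x − x₀⟫ + o(‖x − x₀‖²)` — the hypotheses `hA`, `hpos`, `hS2` of `tendsto_laplaceMethod`
∕ `tendsto_laplaceMethod_chart`.  (`A` = Riesz representative of the Hessian; the linear term vanishes by
`IsLocalMin.fderiv_eq_zero`.) [cite: Breitung1994, Thm 41 p. 56 and Lemma 7 p. 12] -/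
theorem peano_two_of_contDiffAt_of_isLocalMin {F : V → ℝ} {x₀ : V} (hF : ContDiffAt ℝ 2 F x₀)
    (hmin : IsLocalMin F x₀) (hline : ∀ y, y ≠ 0 → 0 < iteratedDeriv 2 (fun t : ℝ => F (x₀ + t • y)) 0) :
    ∃ A : V →ₗ[ℝ] V, A.IsSymmetric ∧ (∀ y, ⟪A y, y⟫_ℝ = iteratedDeriv 2 (fun t : ℝ => F (x₀ + t • y)) 0) ∧
      (∀ y, y ≠ 0 → 0 < ⟪A y, y⟫_ℝ) ∧
      (fun x => F x - F x₀ - (1 / 2) * ⟪A (x - x₀), x - x₀⟫_ℝ) =o[𝓝 x₀] fun x => ‖x - x₀‖ ^ 2 := by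
  obtain ⟨hS1, hS2⟩ := hasFDerivAt_data_of_contDiffAt_two hF
  set S'' : V →L[ℝ] V →L[ℝ] ℝ := fderiv ℝ (fderiv ℝ F) x₀ with hS''
  set A : V →ₗ[ℝ] V :=
    ((InnerProductSpace.continuousLinearMapOfBilin (𝕜 := ℝ) S'' : V →L[ℝ] V) : V →ₗ[ℝ] V) with hAdef
  have hsymm : ∀ v w, S'' v w = S'' w v := second_derivative_symmetric_of_eventually_of_real hS1 hS2
  have hAS' : ∀ y z, ⟪A y, z⟫_ℝ = S'' y z := fun y z => by
    rw [hAdef, ContinuousLinearMap.coe_coe, InnerProductSpace.continuousLinearMapOfBilin_apply]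
  have hA : A.IsSymmetric := fun y z => by
    rw [hAS', hsymm, ← hAS', real_inner_comm]
  have hAline : ∀ y, ⟪A y, y⟫_ℝ = iteratedDeriv 2 (fun t : ℝ => F (x₀ + t • y)) 0 := fun y => by
    rw [hAS', iteratedDeriv_two_along_line hS1 hS2 y]
  have hcrit : fderiv ℝ F x₀ = 0 := hmin.fderiv_eq_zero
  refine ⟨A, hA, hAline, fun y hy => by rw [hAline]; exact hline y hy, ?_⟩
  have h := isLittleO_taylor_two hS1 hS2
  refine h.congr' (Eventually.of_forall fun x => ?_) EventuallyEq.rfl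
  simp only [hcrit, zero_apply, sub_zero, hAS']

end Euclidean

/-! ## §2 Compact groups: concentration from `C²` in exponential coordinates + positive line variations -/

section Group

variable {𝔸 : Type*} [NormedRing 𝔸] [NormedAlgebra ℂ 𝔸] [CompleteSpace 𝔸]
variable {G : Type*} [Group G] [TopologicalSpace G] [IsTopologicalGroup G] [CompactSpace G]
  [MeasurableSpace G] [BorelSpace G]
variable {C : LogChart 𝔸} {ρ : G →* 𝔸} (h : IsChartRep C ρ) [FiniteDimensional ℝ C.lie]
  (hlie : ∀ x ∈ C.lie, ∀ y ∈ C.lie, x * y - y * x ∈ C.lie)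
variable [MeasurableSpace C.lie] [BorelSpace C.lie]
variable (μ : Measure G) [μ.IsHaarMeasure]
variable {V : Type*} [NormedAddCommGroup V] [InnerProductSpace ℝ V] [FiniteDimensional ℝ V]
  [MeasurableSpace V] [BorelSpace V] (e : V ≃L[ℝ] C.lie)

include hlie in
/-- ★★ **Gibbs measures on a compact group concentrate at a unique minimum — qualitative hypotheses.**  Let `G` be a
compact group faithfully represented (`h : IsChartRep C ρ`: `SU(N)`, `U(N)`, every closed `G ≤ U(N)`), `μ` a Haar measure,
`e : V ≃L[ℝ] 𝔤` a Euclidean frame, `f : G → ℝ` continuous with a UNIQUE minimiser `g₀`, and suppose that in exponential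
coordinates `F(v) := f(g₀·Θ(e v))` is `C²` at `0` with POSITIVE SECOND VARIATION ALONG EVERY LINE,
`d²/dt²|₀ f(g₀·Θ(e(t v))) > 0` for `v ≠ 0`.  Then for every continuous `φ`,
`∫_G e^{−βf} φ dμ ∕ ∫_G e^{−βf} dμ ⟶ φ(g₀)` as `β → ∞`.
[cite: Breitung1994, Thm 41 p. 56] [cite: Helgason2000, Ch. I §1 Thm 1.14 (13) p. 96]
[cite: Hwang1980, main theorem (one-point minimum set)] -/
theorem tendsto_gibbs_expectation_haar_of_contDiffAt {f φ : G → ℝ} {g₀ : G}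
    (hf : Continuous f) (hφ : Continuous φ) (hmin : ∀ g, g ≠ g₀ → f g₀ < f g)
    (hF : ContDiffAt ℝ 2 (fun v : V => f (g₀ * h.expChart (e v))) 0)
    (hline : ∀ v : V, v ≠ 0 → 0 < iteratedDeriv 2 (fun t : ℝ => f (g₀ * h.expChart (e (t • v)))) 0) :
    Tendsto (fun β : ℝ => (∫ g, Real.exp (-β * f g) * φ g ∂μ) / ∫ g, Real.exp (-β * f g) ∂μ) atTop
      (𝓝 (φ g₀)) := by
  set F : V → ℝ := fun v => f (g₀ * h.expChart (e v)) with hFdef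
  have hF0 : F 0 = f g₀ := by
    simp only [hFdef, map_zero, IsChartRep.expChart_zero, mul_one]
  have hminF : IsLocalMin F 0 := Filter.Eventually.of_forall fun v => by
    rw [hF0]
    by_cases hv : g₀ * h.expChart (e v) = g₀
    · simp only [hFdef, hv, le_refl]
    · exact (hmin _ hv).le
  have hline' : ∀ y : V, y ≠ 0 → 0 < iteratedDeriv 2 (fun t : ℝ => F (0 + t • y)) 0 := fun y hy => by
    simpa only [hFdef, zero_add, map_smul] using hline y hy
  obtain ⟨A, hA, -, hpos, hS2⟩ := peano_two_of_contDiffAt_of_isLocalMin hF hminF hline'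
  have hS2' : (fun v => f (g₀ * h.expChart (e v)) - f g₀ - (1 / 2) * ⟪A v, v⟫_ℝ) =o[𝓝 0] fun v => ‖v‖ ^ 2 := by
    simpa only [hFdef, map_zero, IsChartRep.expChart_zero, mul_one, sub_zero] using hS2
  exact tendsto_gibbs_expectation_haar h hlie μ e hA hpos hf hφ hmin hS2'

end Group

/-! ## §3 Products `G^B`: the same with the componentwise chart -/

section Pi

variable {𝔸 : Type*} [NormedRing 𝔸] [NormedAlgebra ℂ 𝔸] [CompleteSpace 𝔸]
variable {G : Type*} [Group G] [TopologicalSpace G] [IsTopologicalGroup G] [CompactSpace G]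
  [MeasurableSpace G] [BorelSpace G] [SecondCountableTopology G]
variable {C : LogChart 𝔸} {ρ : G →* 𝔸} (h : IsChartRep C ρ) [FiniteDimensional ℝ C.lie]
  (hlie : ∀ x ∈ C.lie, ∀ y ∈ C.lie, x * y - y * x ∈ C.lie)
variable (B : Type*) [Fintype B]
variable [MeasurableSpace (piLogChart C B).lie] [BorelSpace (piLogChart C B).lie]
variable (μB : Measure (B → G)) [μB.IsHaarMeasure]
variable {W : Type*} [NormedAddCommGroup W] [InnerProductSpace ℝ W] [FiniteDimensional ℝ W]
  [MeasurableSpace W] [BorelSpace W] (e : W ≃L[ℝ] (piLogChart C B).lie)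

include hlie in
/-- ★★ **Gibbs ∕ Wilson-type measures on `G^B` concentrate at a unique minimum — qualitative hypotheses.**  For a compact
group `G` faithfully represented, a finite bond set `B`, any Haar measure `μB` on `B → G` (e.g. `Measure.pi (fun _ => μ)`), a
frame `e : W ≃L[ℝ] 𝔤^B`, `f : (B → G) → ℝ` continuous with a UNIQUE minimiser `U₀` such that
`F(v) := f(U₀ · (b ↦ Θ((e v) b)))` is `C²` at `0` and `d²/dt²|₀ F(t v) > 0` for all `v ≠ 0` (positive second variation of
the action along every one-parameter family `U₀(b)·exp(t·A(b))` — the form in which lattice Hessian computations come),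
and `φ` continuous: `∫ e^{−βf} φ dμB ∕ ∫ e^{−βf} dμB ⟶ φ(U₀)` as `β → ∞`.
[cite: Breitung1994, Thm 41 p. 56] [cite: Helgason2000, Ch. I §1 Thm 1.14 (13) p. 96]
[cite: Hwang1980, main theorem (one-point minimum set)] [cite: Balaban1985UV3, (18) p. 260] -/
theorem tendsto_gibbs_expectation_haar_pi_of_contDiffAt {f φ : (B → G) → ℝ} {U₀ : B → G}
    (hf : Continuous f) (hφ : Continuous φ) (hmin : ∀ U, U ≠ U₀ → f U₀ < f U)
    (hF : ContDiffAt ℝ 2 (fun v : W => f (U₀ * fun b => h.expChart (lieApply C B (e v) b))) 0)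
    (hline : ∀ v : W, v ≠ 0 →
      0 < iteratedDeriv 2 (fun t : ℝ => f (U₀ * fun b => h.expChart (lieApply C B (e (t • v)) b))) 0) :
    Tendsto (fun β : ℝ => (∫ U, Real.exp (-β * f U) * φ U ∂μB) / ∫ U, Real.exp (-β * f U) ∂μB) atTop
      (𝓝 (φ U₀)) := by
  haveI := finiteDimensional_piLogChart_lie C B
  have hfun : ∀ v : W, (U₀ * (isChartRep_pi B h).expChart (e v)) = U₀ * fun b => h.expChart (lieApply C B (e v) b) :=
    fun v => by rw [expChart_pi_eq B h (e v)]
  have hF' : ContDiffAt ℝ 2 (fun v : W => f (U₀ * (isChartRep_pi B h).expChart (e v))) 0 := by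
    have : (fun v : W => f (U₀ * (isChartRep_pi B h).expChart (e v))) =
        fun v : W => f (U₀ * fun b => h.expChart (lieApply C B (e v) b)) := funext fun v => by rw [hfun v]
    rw [this]; exact hF
  have hline' : ∀ v : W, v ≠ 0 →
      0 < iteratedDeriv 2 (fun t : ℝ => f (U₀ * (isChartRep_pi B h).expChart (e (t • v)))) 0 := by
    intro v hv
    have : (fun t : ℝ => f (U₀ * (isChartRep_pi B h).expChart (e (t • v)))) =
        fun t : ℝ => f (U₀ * fun b => h.expChart (lieApply C B (e (t • v)) b)) := funext fun t => by rw [hfun]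
    rw [this]; exact hline v hv
  exact tendsto_gibbs_expectation_haar_of_contDiffAt (isChartRep_pi B h) (lie_adStable_pi C B hlie) μB e hf hφ hmin
    hF' hline'

end Pi

/-! ## §4 `SU(N)^B` -/

section SpecialUnitary

open scoped Matrix.Norms.L2Operator
open Literature.MathematicalPhysics.QuantumLattice (fundamentalRep)

variable {n : Type*} [Fintype n] [DecidableEq n] [Nonempty n]
variable {B' : Type*} [Fintype B']
variable {W' : Type*} [NormedAddCommGroup W'] [InnerProductSpace ℝ W'] [FiniteDimensional ℝ W']
  [MeasurableSpace W'] [BorelSpace W']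

/-- **`SU(N)^B`, qualitative form**: a continuous `f` on `B → SU(N)` with a unique minimiser `U₀`, `C²` in the product
exponential coordinates at `U₀` with positive second variation along every family `U₀(b)·exp(t A(b))`; then
`∫ e^{−βf} φ dμB ∕ ∫ e^{−βf} dμB ⟶ φ(U₀)` for every continuous `φ` and every Haar measure `μB` on `B → SU(N)`.
[cite: Breitung1994, Thm 41 p. 56] [cite: Helgason2000, Ch. I §1 Thm 1.14 (13) p. 96]
[cite: Hwang1980, main theorem (one-point minimum set)] -/
theorem tendsto_gibbs_expectation_haar_pi_specialUnitaryGroup_of_contDiffAt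
    [MeasurableSpace (piLogChart (specialUnitaryLogChart n) B').lie]
    [BorelSpace (piLogChart (specialUnitaryLogChart n) B').lie]
    (μB : Measure (B' → Matrix.specialUnitaryGroup n ℂ)) [μB.IsHaarMeasure]
    (e : W' ≃L[ℝ] (piLogChart (specialUnitaryLogChart n) B').lie)
    {f φ : (B' → Matrix.specialUnitaryGroup n ℂ) → ℝ} {U₀ : B' → Matrix.specialUnitaryGroup n ℂ}
    (hf : Continuous f) (hφ : Continuous φ) (hmin : ∀ U, U ≠ U₀ → f U₀ < f U)
    (hF : ContDiffAt ℝ 2 (fun v : W' => f (U₀ * fun b => (isChartRep_specialUnitaryGroup (n := n)).expChart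
      (lieApply (specialUnitaryLogChart n) B' (e v) b))) 0)
    (hline : ∀ v : W', v ≠ 0 → 0 < iteratedDeriv 2 (fun t : ℝ => f (U₀ * fun b =>
      (isChartRep_specialUnitaryGroup (n := n)).expChart (lieApply (specialUnitaryLogChart n) B' (e (t • v)) b))) 0) :
    Tendsto (fun β : ℝ => (∫ U, Real.exp (-β * f U) * φ U ∂μB) / ∫ U, Real.exp (-β * f U) ∂μB) atTop
      (𝓝 (φ U₀)) :=
  haveI := (isChartRep_specialUnitaryGroup (n := n)).secondCountableTopology
  tendsto_gibbs_expectation_haar_pi_of_contDiffAt (isChartRep_specialUnitaryGroup (n := n))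
    (lie_adStable_specialUnitaryGroup (n := n)) B' μB e hf hφ hmin hF hline

end SpecialUnitary

end Literature.Analysis.Asymptotics
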